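import Summits.CriticalPhenomena.Ising3DConformalLimit.Theorems.GaussianLimitNotScreened.Negative.Reformulation
import Summits.CriticalPhenomena.Ising3DConformalLimit.Theorems.SubPtolemyInterlacingSubPtolemyFloorScreenedEtaBound
import Summits.CriticalPhenomena.Ising3DConformalLimit.Theorems.SubPtolemyInterlacingSubPtolemyFloorHybridCloses
import HarnessLib

/-!
# Crux `GaussianLimitNotScreened` (stmt-CriticalPhenomena-13886), line `free-regular-variation-dcp-window`:
# the corner leaf (γ) is paid by the screened axial lower bound at any gain `s > 0`, and by item 15703 ALONE
# (bookkeeping stub F1 of lead c7)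

THEOREM-ONLY helper file of the crux `Summit.CriticalPhenomena.Ising3DConformalLimit.Theses.PerfectScreening.
GaussianLimitNotScreened` (item stmt-CriticalPhenomena-13886, route PerfectScreening r4): no definitions, no named
facts, closes nothing (`--supports` the item). The crux is split (glue `PerfectScreeningGaussianLimitNotScreenedSplit`,
p137467) into three leaves by the window `Δ ∈ [1/2, 3/4]` of a non-degenerate Möbius-covariant pointwise scaling
limit `(ρ, Δ, S)` of `criticalCorr 3` (`GaussianLimitNotScreenedNegative.dimension_window_and_eta`, Duminil-Copin–Panis
2025 Thm 1.5); leaf (γ) is the corner `Δ = 3/4`: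

  (γ)  `∀ ρ S, ρ > 0 on (0,1] → HasPointwiseScalingLimit (criticalCorr 3) ρ S → IsNondegenerateTwoPoint S →
        IsMoebiusCovariant (3/4) S → HasNontrivialU4 S`.

What is proved (all by VACUITY of the corner — no Gaussianity is used):

* `hasIsingExponentEta_half_of_cornerLimit` — a corner limit makes the critical exponent `η(3) = 1/2` exist in the
  logarithmic sense (`HasIsingExponentEta 3 (1/2)`; `η = 2Δ - 1` from `dimension_window_and_eta`).
* `noMarginalGaussianLimit_of_conditionalEtaHalf` (E1) — the CONDITIONAL STRICT Duminil-Copin–Panis inequality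
  "`η(3) < 1/2` whenever `η(3)` exists" pays (γ): a corner limit would exhibit `η = 1/2`.
* `stub_cornerOfScreenedAxisLower` (the REGISTERED bookkeeping stub F1 of the crux, verbatim) — crux
  stmt-CriticalPhenomena-15703's line proposition `ScreenedAxisLower s` (the screened axial lower bound of
  Duminil-Copin–Panis 2025 Thm 1.3 / eq. (1.9) at `d = 3` with a polynomial gain `n^{s}`, unfolded verbatim as in the
  landed `SubPtolemyFloorScreening.etaBound_of_screenedAxisLower`, p141599) at ANY `s > 0` pays (γ): the landed bound
  gives `1 + η ≤ (3 - s)/2` for every existing `η`, i.e. `η ≤ (1 - s)/2 < 1/2`, and E1 applies.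
* `threshold_sub_one_lt_half` — the number `log₂(1+√2) - 1 ≈ 0.2716` is `< 1/2` (tree: `threshold_lt_three_halves`).
* `noMarginalGaussianLimit_of_subPtolemyFloor` (E2) — item stmt-CriticalPhenomena-15703 `SubPtolemyFloor` ALONE pays
  (γ): the landed `SubPtolemyFloorHybrid.conditionalEta_of_subPtolemyFloor` gives `η < log₂(1+√2) - 1 < 1/2` for every
  existing `η`, and E1 applies. (The crux notes §6 recorded only `15702 ∧ 15703 ⇒ (γ)`; `Interlacing` is not needed.)

Conditional theorems: they credit nothing by themselves (`ScreenedAxisLower s`, `η < 1/2`, `SubPtolemyFloor` are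
open). Deliberately NOT here: the window leaf (β) above `(3 - s)/4` (sibling stub F2, another file), the leaves
themselves.

References: H. Duminil-Copin, R. Panis, *New lower bounds for the (near) critical Ising and φ⁴ models' two-point
functions*, CMP 406 (2025), Theorems 1.3 and 1.5 [DuminilCopinPanis2025LowerBounds].
-/

noncomputable section

namespace Summit.CriticalPhenomena.Ising3DConformalLimit.Cruxes.GaussianLimitNotScreened.FreeRegularVariationDcpWindow

open Filter Topology Set
open Literature.Probability.LatticeModels
open Summit.CriticalPhenomena.Ising3DConformalLimit.Theses.SubPtolemyInterlacing (SubPtolemyFloor)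
open Summit.CriticalPhenomena.Ising3DConformalLimit.SubPtolemyFloorHybrid (conditionalEta_of_subPtolemyFloor)
open Summit.CriticalPhenomena.Ising3DConformalLimit.SubPtolemyFloorNegative (threshold_lt_three_halves)
open Summit.CriticalPhenomena.Ising3DConformalLimit.SubPtolemyFloorScreening (etaBound_of_screenedAxisLower)
open Summit.CriticalPhenomena.Ising3DConformalLimit.GaussianLimitNotScreenedNegative (dimension_window_and_eta)

/-! ## The corner exhibits `η = 1/2` -/

/-- **A corner limit makes `η(3) = 1/2` exist.** For a non-degenerate Möbius-covariant pointwise scaling limit of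
`criticalCorr 3` with `Δ = 3/4` (renormalisation `ρ > 0` on `(0,1]`), the critical exponent `η(3)` exists in the
logarithmic sense and equals `2Δ - 1 = 1/2` (`dimension_window_and_eta`, scale covariance read off Möbius
covariance). [cite: DuminilCopinPanis2025LowerBounds, Theorem 1.5] -/
theorem hasIsingExponentEta_half_of_cornerLimit {ρ : ℝ → ℝ} {S : CorrFamily 3}
    (hρ : ∀ δ ∈ Set.Ioc (0:ℝ) 1, 0 < ρ δ) (hlim : HasPointwiseScalingLimit (criticalCorr 3) ρ S)
    (hnd : IsNondegenerateTwoPoint S) (hM : IsMoebiusCovariant (3 / 4) S) :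
    HasIsingExponentEta 3 (1 / 2) := by
  have h := (dimension_window_and_eta hρ hlim hnd hM.isScaleCovariant).2
  rwa [show (2 : ℝ) * (3 / 4) - 1 = 1 / 2 by norm_num] at h

/-! ## (E1) The conditional strict inequality `η(3) < 1/2` pays leaf (γ) -/

/-- **(E1) `η(3) < 1/2` (if `η(3)` exists) pays the corner leaf (γ).** If every logarithmic critical exponent
`η` of `⟨σ₀σ_x⟩_{β_c(3)}` satisfies `η < 1/2` (the strict form of Duminil-Copin–Panis 2025 Thm 1.5, open), then
every non-degenerate Möbius-covariant pointwise scaling limit of `criticalCorr 3` with `Δ = 3/4` has `U₄ ≢ 0` —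
vacuously: such a limit exhibits `η = 1/2` (`hasIsingExponentEta_half_of_cornerLimit`).
[cite: DuminilCopinPanis2025LowerBounds, Theorem 1.5] -/
theorem noMarginalGaussianLimit_of_conditionalEtaHalf
    (hC : ∀ η : ℝ, HasIsingExponentEta 3 η → η < 1 / 2) :
    ∀ (ρ : ℝ → ℝ) (S : CorrFamily 3), (∀ δ ∈ Set.Ioc (0:ℝ) 1, 0 < ρ δ) →
      HasPointwiseScalingLimit (criticalCorr 3) ρ S → IsNondegenerateTwoPoint S →
      IsMoebiusCovariant (3 / 4) S → HasNontrivialU4 S :=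
  fun _ _ hρ hlim hnd hM =>
    absurd (hC _ (hasIsingExponentEta_half_of_cornerLimit hρ hlim hnd hM)) (lt_irrefl _)

/-! ## (F1) The screened axial lower bound at any gain `s > 0` pays leaf (γ) -/

/-- **REGISTERED BOOKKEEPING STUB F1 `stub_cornerOfScreenedAxisLower` (lead c7) — the screened axial lower bound at
any exponent `s > 0` pays leaf (γ).** If `ScreenedAxisLower s` holds for some `s > 0` — there are `c₁ > 0`, `N₁ ≥ 1`
with `c₁ n^{s} / (χ_{4n} + n Σ_{1≤k≤2n} k⟨σ₀σ_{ke₁}⟩) ≤ ⟨σ₀σ_{ne₁}⟩` for `n ≥ N₁` in the free state at `β_c(3)`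
(Duminil-Copin–Panis 2025 Thm 1.3 / eq. (1.9) at `d = 3` with a gain `n^{s}`; crux 15703's registered
`stub_screenedAxisLower` concludes it from the screened reflected-gradient inequality) — then no non-degenerate
Möbius-covariant pointwise limit of `criticalCorr 3` sits at the corner `Δ = 3/4`: such a limit has `η = 1/2`
(`dimension_window_and_eta`), while the landed `etaBound_of_screenedAxisLower` gives `1 + η ≤ (3 − s)/2 < 3/2` for
every existing `η`. So the conclusion `HasNontrivialU4 S` holds vacuously (no Gaussianity used).
[cite: DuminilCopinPanis2025LowerBounds, Theorem 1.5] -/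
theorem stub_cornerOfScreenedAxisLower :
    ∀ s : ℝ, 0 < s →
    (∃ c₁ : ℝ, 0 < c₁ ∧ ∃ N₁ : ℕ, 0 < N₁ ∧ ∀ n : ℕ, N₁ ≤ n →
      c₁ * (n : ℝ) ^ s / ((∑ x ∈ box 3 (4 * n), twoPointFree 3 (criticalBeta 3) x) +
            (n : ℝ) ^ (3 - 2) *
              ∑ k ∈ Finset.Icc 1 (2 * n),
                (k : ℝ) * twoPointFree 3 (criticalBeta 3) (Pi.single (⟨0, by omega⟩ : Fin 3) (k : ℤ)))
        ≤ twoPointFree 3 (criticalBeta 3) (Pi.single (⟨0, by omega⟩ : Fin 3) (n : ℤ))) →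
    ∀ (ρ : ℝ → ℝ) (S : CorrFamily 3), (∀ δ ∈ Set.Ioc (0:ℝ) 1, 0 < ρ δ) →
      HasPointwiseScalingLimit (criticalCorr 3) ρ S → IsNondegenerateTwoPoint S →
      IsMoebiusCovariant (3 / 4) S → HasNontrivialU4 S := by
  intro s hs h13
  refine noMarginalGaussianLimit_of_conditionalEtaHalf fun η hη => ?_
  have hle : 1 + η ≤ (3 - s) / 2 := etaBound_of_screenedAxisLower s hs.le h13 η hη
  linarith

/-! ## (E2) Item stmt-CriticalPhenomena-15703 `SubPtolemyFloor` alone pays leaf (γ) -/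

/-- `log₂(1+√2) - 1 < 1/2` (from `1 + √2 < 2√2 = 2^{3/2}`, tree `threshold_lt_three_halves`): the conditional
exponent bound produced by `SubPtolemyFloor` is below the corner value `η = 1/2`. [folklore] -/
theorem threshold_sub_one_lt_half : Real.logb 2 (1 + Real.sqrt 2) - 1 < 1 / 2 := by
  linarith [threshold_lt_three_halves]

/-- **(E2) Item stmt-CriticalPhenomena-15703 `SubPtolemyFloor` ALONE pays the corner leaf (γ).** The axial floor r3
of route `SubPtolemyInterlacing` forces `η < log₂(1+√2) - 1` for every existing logarithmic exponent `η(3)` (landed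
`SubPtolemyFloorHybrid.conditionalEta_of_subPtolemyFloor`), and `log₂(1+√2) - 1 < 1/2`
(`threshold_sub_one_lt_half`); so (E1) applies: no non-degenerate Möbius-covariant pointwise limit of
`criticalCorr 3` has `Δ = 3/4`, and `HasNontrivialU4 S` holds vacuously there. (`Interlacing`, item 15702, is not
needed for this leaf.) [cite: DuminilCopinPanis2025LowerBounds, Theorem 1.5] -/
theorem noMarginalGaussianLimit_of_subPtolemyFloor
    (hF : Summit.CriticalPhenomena.Ising3DConformalLimit.Theses.SubPtolemyInterlacing.SubPtolemyFloor) :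
    ∀ (ρ : ℝ → ℝ) (S : CorrFamily 3), (∀ δ ∈ Set.Ioc (0:ℝ) 1, 0 < ρ δ) →
      HasPointwiseScalingLimit (criticalCorr 3) ρ S → IsNondegenerateTwoPoint S →
      IsMoebiusCovariant (3 / 4) S → HasNontrivialU4 S :=
  noMarginalGaussianLimit_of_conditionalEtaHalf fun η hη =>
    (conditionalEta_of_subPtolemyFloor hF η hη).trans threshold_sub_one_lt_half

end Summit.CriticalPhenomena.Ising3DConformalLimit.Cruxes.GaussianLimitNotScreened.FreeRegularVariationDcpWindow

end
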